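import Mathlib.Geometry.Manifold.Instances.Real
import Literature.Topology.FourManifolds.PlanarSmoothStructures
import HarnessLib

/-!
# The carrier of a plane atlas as a smooth surface

Topic `Literature/Topology/FourManifolds` (smoothing theory of surfaces; brick of the `n = 2`
leaf of the named fact `Literature.Topology.FourManifolds.exists_chartedSpace_isManifold_of_le_three`,
spc4.S33). A smooth plane atlas `𝒮 : PlaneAtlas W` (`PlanarSmoothStructures.lean`: an
`AtlasOn (contDiffGroupoid ∞ (𝓡 2)) W` of charts `ℂ ⇀ ℝ²` on the open set `W ⊆ ℂ`) is a
possibly *exotic* smooth structure on the planar open set `W`. To apply Mathlib's and the tree's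
manifold theory to it (proper Morse functions, regular levels, flows: the essential seam of the
smoothing induction caps an exotic annulus by a level circle of a Morse function), this file
registers the structure on the type `𝒮.Man` (a synonym of the subtype `↥W`):

* instances `ChartedSpace (EuclideanSpace ℝ (Fin (1 + 1))) 𝒮.Man`, `IsManifold (𝓡 (1 + 1)) ∞`,
  `T2Space`, `SecondCountableTopology`, `LocallyCompactSpace`, `SigmaCompactSpace`,
  `LocallyConnectedSpace` (the model is written `ℝ¹⁺¹`, definitionally `ℝ²`, because the
  level-set files `RegularLevelSet.lean` / `RegularLevelCollarBand.lean` are stated for models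
  `𝓡 (n + 1)` and instance synthesis does not unfold `1 + 1 = 2`);
* `PlaneAtlas.chart e hne` — a chart `e ∈ 𝒮` restricted to the subtype — belongs to the maximal
  `C^∞` atlas of `𝒮.Man` (`chart_mem_maximalAtlas`), with the expected source, target and
  inverse (`chart_source`, `chart_target`, `val_chart_symm`);
* reading smooth maps in the charts of the atlas: `contDiffOn_chart_comp` (a `C^∞` map into
  `𝒮.Man` from an open set of a normed space, followed by a chart of `𝒮`, is `C^∞`) and
  `contDiffOn_comp_chart_symm` (a `C^∞` vector-valued map on `𝒮.Man`, preceded by the inverse of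
  a chart of `𝒮`, is `C^∞`).

Everything is proved; no named facts.

## References

* A. Hatcher, *The Kirby torus trick for surfaces*, arXiv:1312.3518 (2013) (context: Thm. A).
* E. E. Moise, *Geometric topology in dimensions 2 and 3*, GTM 47 (1977), Ch. 8.
-/


noncomputable section

namespace Literature.Topology.FourManifolds

open _root_.Set _root_.Metric _root_.OpenPartialHomeomorph _root_.Filter
open scoped _root_.Manifold _root_.Topology _root_.ContDiff
open Literature.Geometry.Manifold (AtlasOn)
open Literature.Geometry.Manifold.AtlasOn

/-- Local notation for the model plane `ℝ²` (charts of plane atlases). -/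
local notation "𝔼₂" => EuclideanSpace ℝ (Fin 2)

/-- Local notation for the model plane `ℝ²` in the form `ℝ¹⁺¹` expected by the level-set files
(`RegularLevelSet.lean`, `RegularLevelCollarBand.lean`); definitionally equal to `𝔼₂`. -/
local notation "𝔼₁₊₁" => EuclideanSpace ℝ (Fin (1 + 1))

namespace PlaneAtlas

variable {W : Set ℂ} (𝒮 : PlaneAtlas W)

/-! ### The carrier of a plane atlas as a smooth surface -/

/-- **The carrier of a plane atlas as a type** — a synonym of the open subspace `W = 𝒮.opens`
of `ℂ` — on which the smooth structure of `𝒮` is registered as instances (`ChartedSpace`,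
`IsManifold (𝓡 2) ∞`): an "exotic" smooth surface whose underlying topological space is the
planar open set `W`. [folklore] -/
def Man (𝒮 : PlaneAtlas W) : Type := ↥𝒮.opens

/-- The carrier has the subspace topology. [folklore] -/
instance : TopologicalSpace 𝒮.Man := inferInstanceAs (TopologicalSpace ↥𝒮.opens)

/-- The carrier is Hausdorff. [folklore] -/
instance : T2Space 𝒮.Man := inferInstanceAs (T2Space ↥𝒮.opens)

/-- The carrier is second countable. [folklore] -/
instance : SecondCountableTopology 𝒮.Man := inferInstanceAs (SecondCountableTopology ↥𝒮.opens)

/-- The charted-space structure of the atlas on its carrier (model written `ℝ¹⁺¹`). [folklore] -/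
instance : ChartedSpace 𝔼₁₊₁ 𝒮.Man := 𝒮.subtypeChartedSpace

/-- The carrier is a `C^∞` surface. [folklore] -/
instance : IsManifold (𝓡 (1 + 1)) ∞ 𝒮.Man :=
  @IsManifold.mk' _ _ _ _ _ _ _ (𝓡 (1 + 1)) ∞ 𝒮.Man _ _ 𝒮.subtypeHasGroupoid

/-- The carrier is locally compact. [folklore] -/
instance : LocallyCompactSpace 𝒮.Man := ChartedSpace.locallyCompactSpace 𝔼₁₊₁ 𝒮.Man

/-- The carrier is locally connected. [folklore] -/
instance : LocallyConnectedSpace 𝒮.Man := ChartedSpace.locallyConnectedSpace 𝔼₁₊₁ 𝒮.Man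

/-- The carrier is σ-compact. [folklore] -/
instance : SigmaCompactSpace 𝒮.Man := sigmaCompactSpace_of_locallyCompact_secondCountable

/-- The underlying point of the plane. [folklore] -/
def val (x : 𝒮.Man) : ℂ := (show ↥𝒮.opens from x).1

/-- Points of `𝒮.Man` lie in `W`. [folklore] -/
theorem val_mem (x : 𝒮.Man) : 𝒮.val x ∈ W := (show ↥𝒮.opens from x).2

/-- The point of `𝒮.Man` over `z ∈ W`. [folklore] -/
def mk (z : ℂ) (hz : z ∈ W) : 𝒮.Man := (⟨z, hz⟩ : ↥𝒮.opens)

/-- `val (mk z) = z`. [folklore] -/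
@[simp] theorem val_mk (z : ℂ) (hz : z ∈ W) : 𝒮.val (𝒮.mk z hz) = z := rfl

/-- `mk (val x) = x`. [folklore] -/
@[simp] theorem mk_val (x : 𝒮.Man) : 𝒮.mk (𝒮.val x) (𝒮.val_mem x) = x := rfl

/-- `val` is injective. [folklore] -/
theorem val_injective : Function.Injective 𝒮.val := fun _ _ h => Subtype.ext h

/-- `val` is the subtype inclusion: an embedding. [folklore] -/
theorem isEmbedding_val : Topology.IsEmbedding 𝒮.val := Topology.IsEmbedding.subtypeVal

/-- `val` is continuous. [folklore] -/
theorem continuous_val : Continuous 𝒮.val := continuous_subtype_val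

/-- `val` is an open map (`W` is open). [folklore] -/
theorem isOpenMap_val : IsOpenMap 𝒮.val := 𝒮.opens.2.isOpenMap_subtype_val

/-- The range of `val` is `W`. [folklore] -/
theorem range_val : range 𝒮.val = W := Subtype.range_val

/-- The carrier is nonempty as soon as `W` is. [folklore] -/
theorem nonempty_opens {z : ℂ} (hz : z ∈ W) : Nonempty 𝒮.opens := ⟨⟨z, hz⟩⟩

/-! ### Charts of the atlas as charts of the surface -/

/-- A chart `e ∈ 𝒮` restricted to the subtype: a chart of `𝒮.Man`. [folklore] -/
def chart (e : OpenPartialHomeomorph ℂ 𝔼₂) (hne : Nonempty 𝒮.opens) : OpenPartialHomeomorph 𝒮.Man 𝔼₂ :=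
  e.subtypeRestr (s := 𝒮.opens) hne

variable {𝒮}

/-- The restricted chart as a function. [folklore] -/
@[simp] theorem chart_apply (e : OpenPartialHomeomorph ℂ 𝔼₂) (hne : Nonempty 𝒮.opens) (x : 𝒮.Man) :
    𝒮.chart e hne x = e (𝒮.val x) := rfl

/-- The source of the restricted chart. [folklore] -/
theorem chart_source (e : OpenPartialHomeomorph ℂ 𝔼₂) (hne : Nonempty 𝒮.opens) :
    (𝒮.chart e hne).source = 𝒮.val ⁻¹' e.source := subtypeRestr_source _ _

/-- The target of the restricted chart of a chart of the atlas is the whole target. [folklore] -/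
theorem chart_target {e : OpenPartialHomeomorph ℂ 𝔼₂} (he : e ∈ 𝒮.charts) (hne : Nonempty 𝒮.opens) :
    (𝒮.chart e hne).target = e.target := by
  refine (subtypeRestr_target_subset _ _).antisymm fun y hy => ?_
  show y ∈ (e.subtypeRestr (s := 𝒮.opens) hne).target
  rw [subtypeRestr_def, trans_target]
  refine ⟨hy, ?_⟩
  rw [mem_preimage, TopologicalSpace.Opens.openPartialHomeomorphSubtypeCoe_target]
  exact 𝒮.source_subset e he (e.map_target hy)

/-- The inverse of the restricted chart lies over `e⁻¹`. [folklore] -/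
theorem val_chart_symm {e : OpenPartialHomeomorph ℂ 𝔼₂} (he : e ∈ 𝒮.charts) (hne : Nonempty 𝒮.opens)
    {y : 𝔼₂} (hy : y ∈ e.target) : 𝒮.val ((𝒮.chart e hne).symm y) = e.symm y := by
  have := e.subtypeRestr_symm_apply hne (by rw [← chart, chart_target he hne]; exact hy)
  exact this

/-- **The restricted charts of the atlas belong to the maximal atlas of the surface.**
[folklore] -/
theorem chart_mem_maximalAtlas {e : OpenPartialHomeomorph ℂ 𝔼₂} (he : e ∈ 𝒮.charts) (hne : Nonempty 𝒮.opens) :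
    𝒮.chart e hne ∈ IsManifold.maximalAtlas (𝓡 (1 + 1)) ∞ 𝒮.Man := by
  rw [IsManifold.mem_maximalAtlas_iff, _root_.mem_maximalAtlas_iff]
  rintro e' ⟨_, ⟨x, rfl⟩, he'⟩
  rw [mem_singleton_iff] at he'
  subst he'
  have key : ∀ f f' : OpenPartialHomeomorph ℂ 𝔼₂, f ∈ 𝒮.charts → f' ∈ 𝒮.charts →
      (f.subtypeRestr (s := 𝒮.opens) hne).symm ≫ₕ f'.subtypeRestr (s := 𝒮.opens) hne ∈ contDiffGroupoid ∞ (𝓡 (1 + 1)) :=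
    fun f f' hf hf' => (contDiffGroupoid ∞ (𝓡 (1 + 1))).mem_of_eqOnSource
      (closedUnderRestriction' (𝒮.compatible f hf f' hf') (f.isOpen_inter_preimage_symm 𝒮.opens.2))
      (subtypeRestr_symm_trans_subtypeRestr (s := 𝒮.opens) hne f f')
  exact ⟨key e _ he (𝒮.chartAt'_mem x), key _ e (𝒮.chartAt'_mem x) he⟩

/-! ### Reading smooth maps in the charts of the atlas -/

/-- **A smooth map into the surface, read in a chart of the atlas, is smooth**: if
`c : N → 𝒮.Man` is `C^∞` on the open set `s` then `e ∘ val ∘ c` is `C^∞` on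
`s ∩ c⁻¹(e.source)` for every chart `e ∈ 𝒮` (here `N` is an open subset situation: a map from a
real normed space `F`, smoothness `ContMDiffOn 𝓘(ℝ, F) (𝓡 (1 + 1))`). [folklore] -/
theorem contDiffOn_chart_comp {F : Type*} [NormedAddCommGroup F] [NormedSpace ℝ F] {c : F → 𝒮.Man} {s : Set F}
    (hc : ContMDiffOn 𝓘(ℝ, F) (𝓡 (1 + 1)) ∞ c s) {e : OpenPartialHomeomorph ℂ 𝔼₂} (he : e ∈ 𝒮.charts) :
    ContDiffOn ℝ ∞ (fun x => e (𝒮.val (c x))) (s ∩ c ⁻¹' (𝒮.val ⁻¹' e.source)) := by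
  rcases isEmpty_or_nonempty 𝒮.opens with hemp | hne
  · intro x hx; exact (hemp.false (c x)).elim
  set s' := s ∩ c ⁻¹' (𝒮.val ⁻¹' e.source) with hs'
  have h1 : ContMDiffOn 𝓘(ℝ, F) (𝓡 (1 + 1)) ∞ c s' := hc.mono inter_subset_left
  have hmaps : MapsTo c s' (𝒮.chart e hne).source := fun x hx => by rw [chart_source]; exact hx.2
  have key := (contMDiffOn_iff_of_mem_maximalAtlas' (I := 𝓘(ℝ, F)) (I' := 𝓡 (1 + 1)) (n := ∞)
    (e := OpenPartialHomeomorph.refl F) (e' := 𝒮.chart e hne)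
    (by rw [IsManifold.mem_maximalAtlas_iff]; exact StructureGroupoid.subset_maximalAtlas _ (by simp))
    (chart_mem_maximalAtlas he hne) (subset_univ _) hmaps).1 h1
  simp only [OpenPartialHomeomorph.extend, refl_partialEquiv, modelWithCornersSelf_partialEquiv, PartialEquiv.refl_trans,
    PartialEquiv.refl_coe, id_eq, image_id', PartialEquiv.refl_symm] at key
  exact key.congr fun x _ => rfl

/-- **A smooth real-vector-valued map on the surface, read in a chart of the atlas, is
smooth**: if `g : 𝒮.Man → F` is `C^∞` on the open set `U` then `g ∘ e⁻¹` (precisely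
`g ∘ (chart e)⁻¹`) is `C^∞` on `e(U ∩ e.source)`, for every chart `e ∈ 𝒮`. [folklore] -/
theorem contDiffOn_comp_chart_symm {F : Type*} [NormedAddCommGroup F] [NormedSpace ℝ F] {g : 𝒮.Man → F}
    {U : Set 𝒮.Man} (hg : ContMDiffOn (𝓡 (1 + 1)) 𝓘(ℝ, F) ∞ g U) {e : OpenPartialHomeomorph ℂ 𝔼₂}
    (he : e ∈ 𝒮.charts) (hne : Nonempty 𝒮.opens) :
    ContDiffOn ℝ ∞ (g ∘ (𝒮.chart e hne).symm) (𝒮.chart e hne '' (U ∩ (𝒮.chart e hne).source)) := by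
  set s' := U ∩ (𝒮.chart e hne).source with hs'
  have h1 : ContMDiffOn (𝓡 (1 + 1)) 𝓘(ℝ, F) ∞ g s' := hg.mono inter_subset_left
  have key := (contMDiffOn_iff_of_mem_maximalAtlas' (I := 𝓡 (1 + 1)) (I' := 𝓘(ℝ, F)) (n := ∞)
    (e := 𝒮.chart e hne) (e' := OpenPartialHomeomorph.refl F)
    (chart_mem_maximalAtlas he hne)
    (by rw [IsManifold.mem_maximalAtlas_iff]; exact StructureGroupoid.subset_maximalAtlas _ (by simp))
    inter_subset_right (mapsTo_univ _ _)).1 h1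
  simpa only [OpenPartialHomeomorph.extend, refl_partialEquiv, modelWithCornersSelf_partialEquiv, PartialEquiv.refl_trans,
    PartialEquiv.refl_coe, PartialEquiv.trans_refl, toFun_eq_coe, coe_toPartialEquiv_symm, Function.id_comp] using key

end PlaneAtlas

end Literature.Topology.FourManifolds

end
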